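import Mathlib.Analysis.Normed.Group.Basic
import Mathlib.Algebra.BigOperators.Finsupp.Basic
import Mathlib.Data.Finsupp.SMul
import Mathlib.Data.Real.Basic
import Mathlib.Algebra.Order.BigOperators.Group.Finset
import Mathlib.Algebra.Order.BigOperators.Ring.Finset
import HarnessLib

/-!
# Finitely supported laws of rooted point patterns and the finite-level mass-transport identity

A *rooted pattern* in a normed group `E` (think `E = ℝ³`) is a finite set `P : Finset E` of
RELATIVE positions of the points seen from a distinguished point, the root, which sits at `0` and
is not listed. For a stationary (or just unimodular / Palm-type) simple point process and a radius
`R`, the pattern `P_R(x)` of the points within distance `R` of a typical point `x` is such a rooted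
pattern, and its law `μ_R` — a probability law on rooted patterns — inherits from the
**Mass-Transport Principle** (Aldous–Lyons: a random rooted network is *unimodular* iff
`𝔼 Σ_x f(G, o, x) = 𝔼 Σ_x f(G, x, o)` for all `f ≥ 0` of a network with an ordered pair of
distinguished vertices [AldousLyons2007, §2, Definition of unimodularity]; for point processes in
Euclidean space loc. cit. §1 Example "Voronoi tilings" / Palm calculus) the family of linear
identities obtained by taking for `f(o, x)` a function of the displacement `v = x − o` and of the two
`r`-patterns around `o` and around `x`, for neighbours `x` with `|v| ≤ R − r` — exactly the range
in which BOTH `r`-balls lie inside the `R`-ball of the root, so that both patterns are read off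
`P_R(o)` (the "lens" `B_r(o) ∪ B_r(x) ⊆ B_R(o)`):

  `𝔼_μ Σ_{v ∈ P, |v| ≤ R−r} g(v, P ∩ B_r, (P ∪ {0} − v) ∩ B_r ∖ {0})`
  `= 𝔼_μ Σ_{v ∈ P, |v| ≤ R−r} g(−v, (P ∪ {0} − v) ∩ B_r ∖ {0}, P ∩ B_r)`     (MT_{R,r})

for every `g : E → Finset E → Finset E → ℝ` (re-rooting at a neighbour inside the lens preserves
the joint statistics of displacement and the two `r`-patterns). These are the defining linear
constraints of the finite-level relaxations of the set of Palm laws — the continuum analogue of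
the Kaburagi–Kanamori *configurational polytope* of lattice-gas ground-state theory
[KaburagiKanamori1975] — used as the primal objects ("lens-consistent rooted laws") of route
`AtomisticToContinuum/Crystallization/FrustrationRangeLP` (items TransferDuality, FrustrationFloor).

## Contents (definitions with bodies; all lemmas proved)
* `IsRootedPattern δ R P` — admissibility: all norms in `[δ, R]`, pairwise distances `≥ δ`
  (hard-core separation `δ`, observation radius `R`);
* `ballPattern r P = P ∩ B̄_r`, `lens r R P = {v ∈ P | ‖v‖ ≤ R − r}`,
  `reroot P v = ((P ∪ {0}) − v) ∖ {0}` (the pattern re-rooted at its point `v`);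
* `PatternLaw E` — a finitely supported probability law `μ = Σ_k w_k δ_{P_k}` on rooted patterns
  (`weight : Finset E →₀ ℝ`, nonnegative, total mass `1`), its expectation functional
  `PatternLaw.expect μ F = Σ_k w_k F(P_k)` (`expect_add`, `expect_const_mul`, `expect_const`,
  `expect_nonneg`, `expect_mono`), Dirac laws `PatternLaw.dirac` and mixtures `PatternLaw.mix`
  (`expect_dirac`, `expect_mix`);
* `LensConsistentLaw E δ r R` — a pattern law supported on `(δ, R)`-admissible rooted patterns
  and satisfying (MT_{R,r}) for all `g`; `massTransport_expect`; it is a convex set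
  (`LensConsistentLaw.mix`) containing the vacuum law (`LensConsistentLaw.vacuum`, empty pattern)
  and the symmetric dimer laws `½ δ_{{v}} + ½ δ_{{−v}}` (`LensConsistentLaw.dimer`) — the latter a
  genuinely two-sided instance of (MT_{R,r}) (`δ_{{v}}` alone violates it).

## Design notes
* `E` is any `NormedAddCommGroup` with decidable equality (the route: `EuclideanSpace ℝ (Fin 3)`
  under `open scoped Classical`); balls are CLOSED (`‖w‖ ≤ r`), as the route's `dist ≤ R`.
* No sign/order hypotheses on `δ, r, R` are built into the definitions (the route uses
  `0 < δ`, `0 < r ≤ R`); for `r > R` the lens is empty and (MT) is vacuous, for `δ ≤ 0` the root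
  may be duplicated in a pattern — callers assume `0 < δ`.
* Finitely supported laws only (the LP variables at finite level). NOT here: laws on rooted
  locally finite configurations (genuine Palm measures of point processes, the `R = ∞` object),
  the lens-consistent law of a periodic configuration (uniform root over the motif), and the
  dual side (transfer rules); these are further requests of the route.

## References
* D. Aldous, R. Lyons, *Processes on unimodular random networks*, Electron. J. Probab. 12 (2007),
  §2 (unimodularity = Mass-Transport Principle; involution invariance). [AldousLyons2007]
* M. Kaburagi, J. Kanamori, *A method of determining the ground state of the extended-range
  classical lattice gas model*, Progr. Theor. Phys. 54 (1975) (configurational polytope).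
  [KaburagiKanamori1975]
-/

noncomputable section

open Finset

namespace Literature.Probability.PointProcesses

variable {E : Type*} [NormedAddCommGroup E]

/-! ### Rooted patterns -/

/-- **Admissible rooted pattern** at separation `δ` and radius `R`: a finite set `P` of relative
positions (root at `0`, not listed) with every norm in `[δ, R]` and all pairwise distances `≥ δ`
(hard core). [folklore] -/
def IsRootedPattern (δ R : ℝ) (P : Finset E) : Prop :=
  (∀ v ∈ P, δ ≤ ‖v‖ ∧ ‖v‖ ≤ R) ∧ ∀ v ∈ P, ∀ w ∈ P, v ≠ w → δ ≤ ‖v - w‖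

/-- The part of a pattern inside the closed ball `B̄_r(0)`. [folklore] -/
def ballPattern (r : ℝ) (P : Finset E) : Finset E :=
  P.filter fun w => ‖w‖ ≤ r

/-- The **lens range**: the points `v ∈ P` with `‖v‖ ≤ R − r`, i.e. those neighbours whose
`r`-ball lies inside the `R`-ball of the root. [folklore] -/
def lens (r R : ℝ) (P : Finset E) : Finset E :=
  P.filter fun v => ‖v‖ ≤ R - r

/-- **Re-rooting** a pattern at one of its points `v`: translate `P ∪ {0}` by `−v` (the old root
becomes the point `−v`) and delete the new root `0 = v − v`. [folklore] -/
def reroot [DecidableEq E] (P : Finset E) (v : E) : Finset E :=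
  ((insert (0 : E) P).image fun w => w - v).erase 0

/-- The empty pattern is admissible. [folklore] -/
theorem isRootedPattern_empty (δ R : ℝ) : IsRootedPattern δ R (∅ : Finset E) := by
  simp [IsRootedPattern]

/-- A one-point pattern `{v}` with `δ ≤ ‖v‖ ≤ R` is admissible. [folklore] -/
theorem isRootedPattern_singleton {δ R : ℝ} {v : E} (h₁ : δ ≤ ‖v‖) (h₂ : ‖v‖ ≤ R) :
    IsRootedPattern δ R ({v} : Finset E) := by
  refine ⟨fun w hw => ?_, fun w hw w' hw' hne => ?_⟩
  · rw [mem_singleton] at hw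
    subst hw
    exact ⟨h₁, h₂⟩
  · rw [mem_singleton] at hw hw'
    exact absurd (hw.trans hw'.symm) hne

/-- The lens range of a one-point pattern. [folklore] -/
theorem lens_singleton (r R : ℝ) (u : E) :
    lens r R ({u} : Finset E) = if ‖u‖ ≤ R - r then {u} else ∅ :=
  Finset.filter_singleton _ u

/-- The lens range of the empty pattern is empty. [folklore] -/
@[simp] theorem lens_empty (r R : ℝ) : lens r R (∅ : Finset E) = ∅ := by simp [lens]

/-- Re-rooting the one-point pattern `{v}` (`v ≠ 0`) at `v` gives `{−v}`: the old root seen from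
`v`. [folklore] -/
theorem reroot_singleton_self [DecidableEq E] {v : E} (hv : v ≠ 0) :
    reroot ({v} : Finset E) v = {-v} := by
  ext w
  simp only [reroot, mem_erase, mem_image, mem_insert, mem_singleton]
  constructor
  · rintro ⟨hw0, u, hu, rfl⟩
    rcases hu with rfl | rfl
    · exact zero_sub v
    · exact absurd (sub_self _) hw0
  · rintro rfl
    exact ⟨neg_ne_zero.2 hv, 0, Or.inl rfl, zero_sub v⟩

/-! ### Finitely supported laws on rooted patterns -/

/-- A **finitely supported probability law on rooted patterns**, `μ = Σ_k w_k δ_{P_k}`: a finitely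
supported nonnegative weight vector on `Finset E` of total mass `1`. [folklore] -/
structure PatternLaw (E : Type*) [NormedAddCommGroup E] where
  /-- the weights `w_k = μ {P_k}` -/
  weight : Finset E →₀ ℝ
  /-- weights are nonnegative -/
  weight_nonneg : ∀ P, 0 ≤ weight P
  /-- total mass one -/
  total : (weight.sum fun _ w => w) = 1

namespace PatternLaw

variable (μ : PatternLaw E)

/-- The **expectation** `𝔼_μ[F] = Σ_k w_k F(P_k)` of a pattern functional `F` (e.g. the
`R`-truncated half site energy `P ↦ ½ Σ_{v ∈ P} V(‖v‖)`, or a coordination indicator).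
[folklore] -/
def expect (F : Finset E → ℝ) : ℝ :=
  μ.weight.sum fun P w => w * F P

/-- Unfolding of `expect` as a finite sum over the support. [folklore] -/
theorem expect_eq_sum (F : Finset E → ℝ) :
    μ.expect F = ∑ P ∈ μ.weight.support, μ.weight P * F P :=
  rfl

/-- Expectation is additive. [folklore] -/
theorem expect_add (F G : Finset E → ℝ) :
    μ.expect (fun P => F P + G P) = μ.expect F + μ.expect G := by
  simp only [expect_eq_sum, mul_add, sum_add_distrib]

/-- Expectation is homogeneous. [folklore] -/
theorem expect_const_mul (c : ℝ) (F : Finset E → ℝ) :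
    μ.expect (fun P => c * F P) = c * μ.expect F := by
  simp only [expect_eq_sum, mul_sum]
  refine sum_congr rfl fun P _ => ?_
  ring

/-- The expectation of a constant is the constant (total mass one). [folklore] -/
theorem expect_const (c : ℝ) : μ.expect (fun _ => c) = c := by
  have h : ∑ P ∈ μ.weight.support, μ.weight P = 1 := μ.total
  rw [expect_eq_sum, ← sum_mul, h, one_mul]

/-- Expectation of a functional nonnegative on the support is nonnegative. [folklore] -/
theorem expect_nonneg {F : Finset E → ℝ} (hF : ∀ P ∈ μ.weight.support, 0 ≤ F P) :
    0 ≤ μ.expect F :=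
  sum_nonneg fun P hP => mul_nonneg (μ.weight_nonneg P) (hF P hP)

/-- Expectation is monotone (on the support). [folklore] -/
theorem expect_mono {F G : Finset E → ℝ} (hFG : ∀ P ∈ μ.weight.support, F P ≤ G P) :
    μ.expect F ≤ μ.expect G :=
  sum_le_sum fun P hP => mul_le_mul_of_nonneg_left (hFG P hP) (μ.weight_nonneg P)

/-- The **Dirac law** `δ_P` at one pattern. [folklore] -/
def dirac (P : Finset E) : PatternLaw E where
  weight := Finsupp.single P 1
  weight_nonneg Q := by
    by_cases h : P = Q
    · subst h; simp
    · simp [h]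
  total := by rw [Finsupp.sum_single_index rfl]

/-- `𝔼_{δ_P}[F] = F(P)`. [folklore] -/
@[simp] theorem expect_dirac (P : Finset E) (F : Finset E → ℝ) : (dirac P).expect F = F P := by
  rw [expect, dirac, Finsupp.sum_single_index (zero_mul _), one_mul]

/-- The support of a Dirac law. [folklore] -/
theorem support_dirac (P : Finset E) : (dirac P : PatternLaw E).weight.support = {P} :=
  Finsupp.support_single _ one_ne_zero

variable {μ}

/-- The **mixture** `t μ + (1 − t) ν` of two pattern laws, `0 ≤ t ≤ 1`. [folklore] -/
def mix (μ ν : PatternLaw E) (t : ℝ) (ht₀ : 0 ≤ t) (ht₁ : t ≤ 1) : PatternLaw E where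
  weight := t • μ.weight + (1 - t) • ν.weight
  weight_nonneg P := by
    simp only [Finsupp.add_apply, Finsupp.smul_apply, smul_eq_mul]
    exact add_nonneg (mul_nonneg ht₀ (μ.weight_nonneg P))
      (mul_nonneg (sub_nonneg.2 ht₁) (ν.weight_nonneg P))
  total := by
    rw [Finsupp.sum_add_index' (fun _ => rfl) (fun _ _ _ => rfl),
      Finsupp.sum_smul_index' (fun _ => rfl), Finsupp.sum_smul_index' (fun _ => rfl)]
    have hμ := congrArg (fun x => t * x) μ.total
    have hν := congrArg (fun x => (1 - t) * x) ν.total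
    simp only [Finsupp.mul_sum] at hμ hν
    simp only [smul_eq_mul]
    rw [hμ, hν]
    ring

/-- The support of a mixture lies in the union of the supports. [folklore] -/
theorem support_mix_subset [DecidableEq E] (μ ν : PatternLaw E) (t : ℝ) (ht₀ : 0 ≤ t) (ht₁ : t ≤ 1) :
    (mix μ ν t ht₀ ht₁).weight.support ⊆ μ.weight.support ∪ ν.weight.support :=
  Finsupp.support_add.trans (union_subset_union Finsupp.support_smul Finsupp.support_smul)

/-- **Expectation is affine in the law**: `𝔼_{tμ+(1−t)ν}[F] = t 𝔼_μ[F] + (1 − t) 𝔼_ν[F]`. [folklore] -/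
theorem expect_mix (μ ν : PatternLaw E) (t : ℝ) (ht₀ : 0 ≤ t) (ht₁ : t ≤ 1) (F : Finset E → ℝ) :
    (mix μ ν t ht₀ ht₁).expect F = t * μ.expect F + (1 - t) * ν.expect F := by
  unfold expect
  rw [show (mix μ ν t ht₀ ht₁).weight = t • μ.weight + (1 - t) • ν.weight from rfl,
    Finsupp.sum_add_index' (fun _ => zero_mul _) (fun _ _ _ => add_mul _ _ _),
    Finsupp.sum_smul_index' (fun _ => zero_mul _), Finsupp.sum_smul_index' (fun _ => zero_mul _),
    Finsupp.mul_sum, Finsupp.mul_sum]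
  simp only [smul_eq_mul, mul_assoc]

end PatternLaw

/-! ### Lens-consistent laws: the finite-level mass-transport identities -/

/-- A **level-`(R, r)` lens-consistent rooted law** at separation `δ`: a finitely supported
probability law `μ = Σ_k w_k δ_{P_k}` on rooted patterns, supported on `(δ, R)`-admissible patterns
(`IsRootedPattern`), satisfying the **mass-transport identities** (MT_{R,r}): for every
`g : E → Finset E → Finset E → ℝ`,
`Σ_k w_k Σ_{v ∈ P_k, ‖v‖ ≤ R−r} g(v, P_k ∩ B̄_r, ((P_k ∪ {0}) − v) ∩ B̄_r ∖ {0})`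
`= Σ_k w_k Σ_{v ∈ P_k, ‖v‖ ≤ R−r} g(−v, ((P_k ∪ {0}) − v) ∩ B̄_r ∖ {0}, P_k ∩ B̄_r)` —
the Mass-Transport Principle of Aldous–Lyons (`𝔼 Σ_x f(o, x) = 𝔼 Σ_x f(x, o)`, unimodularity),
applied to transports `f(o, x) = g(x − o, P_r(o), P_r(x))` supported on pairs at distance
`≤ R − r`, for which both `r`-patterns are determined by the `R`-pattern of the root. Every Palm
law of `R`-patterns of a stationary hard-core point process satisfies them; the finitely supported
solutions form the level-`(R, r)` polytope of route `FrustrationRangeLP` (continuum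
Kaburagi–Kanamori configurational polytope [KaburagiKanamori1975]).
[cite: AldousLyons2007, §2 (Definition of unimodularity: Mass-Transport Principle)] -/
structure LensConsistentLaw (E : Type*) [NormedAddCommGroup E] [DecidableEq E] (δ r R : ℝ)
    extends PatternLaw E where
  /-- the law lives on `(δ, R)`-admissible rooted patterns -/
  supported : ∀ P ∈ weight.support, IsRootedPattern δ R P
  /-- the mass-transport identities at level `(R, r)` -/
  massTransport : ∀ g : E → Finset E → Finset E → ℝ,
    (weight.sum fun P w => w * ∑ v ∈ lens r R P, g v (ballPattern r P) (ballPattern r (reroot P v))) =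
      weight.sum fun P w => w * ∑ v ∈ lens r R P, g (-v) (ballPattern r (reroot P v)) (ballPattern r P)

namespace LensConsistentLaw

variable [DecidableEq E] {δ r R : ℝ}

/-- (MT_{R,r}) in terms of expectations. [cite: AldousLyons2007, §2 (Mass-Transport Principle)] -/
theorem massTransport_expect (μ : LensConsistentLaw E δ r R) (g : E → Finset E → Finset E → ℝ) :
    μ.expect (fun P => ∑ v ∈ lens r R P, g v (ballPattern r P) (ballPattern r (reroot P v))) =
      μ.expect (fun P => ∑ v ∈ lens r R P, g (-v) (ballPattern r (reroot P v)) (ballPattern r P)) :=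
  μ.massTransport g

variable (E δ r R) in
/-- The **vacuum law** `δ_∅` (an isolated root): admissible and trivially lens-consistent (all
lens sums are empty). [folklore] -/
def vacuum : LensConsistentLaw E δ r R where
  toPatternLaw := PatternLaw.dirac ∅
  supported P hP := by
    rw [PatternLaw.support_dirac, mem_singleton] at hP
    subst hP
    exact isRootedPattern_empty δ R
  massTransport g := by
    show (PatternLaw.dirac ∅).expect _ = (PatternLaw.dirac ∅).expect _
    rw [PatternLaw.expect_dirac, PatternLaw.expect_dirac, lens_empty, sum_empty, sum_empty]

/-- **Lens-consistent laws form a convex set**: mixtures of lens-consistent laws (same `δ, r, R`)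
are lens-consistent — (MT_{R,r}) is linear in the weights. [folklore] -/
def mix (μ ν : LensConsistentLaw E δ r R) (t : ℝ) (ht₀ : 0 ≤ t) (ht₁ : t ≤ 1) :
    LensConsistentLaw E δ r R where
  toPatternLaw := PatternLaw.mix μ.toPatternLaw ν.toPatternLaw t ht₀ ht₁
  supported P hP := by
    rcases mem_union.1 (PatternLaw.support_mix_subset _ _ t ht₀ ht₁ hP) with h | h
    · exact μ.supported P h
    · exact ν.supported P h
  massTransport g := by
    show (PatternLaw.mix μ.toPatternLaw ν.toPatternLaw t ht₀ ht₁).expect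
        (fun P => ∑ v ∈ lens r R P, g v (ballPattern r P) (ballPattern r (reroot P v))) =
      (PatternLaw.mix μ.toPatternLaw ν.toPatternLaw t ht₀ ht₁).expect
        (fun P => ∑ v ∈ lens r R P, g (-v) (ballPattern r (reroot P v)) (ballPattern r P))
    rw [PatternLaw.expect_mix, PatternLaw.expect_mix, massTransport_expect, massTransport_expect]

/-- **The symmetric dimer law** `½ δ_{{v}} + ½ δ_{{−v}}` (`0 < δ ≤ ‖v‖ ≤ R`): the root has a single
neighbour at `±v` with probability `½` each. It is lens-consistent: re-rooting `{v}` at `v` gives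
`{−v}` and vice versa, so the two Dirac halves are exchanged by (MT_{R,r}) — whereas `δ_{{v}}` alone
is not lens-consistent when `‖v‖ ≤ R − r`. [folklore] -/
def dimer (hδ : 0 < δ) (v : E) (hv : δ ≤ ‖v‖) (hvR : ‖v‖ ≤ R) : LensConsistentLaw E δ r R where
  toPatternLaw :=
    PatternLaw.mix (PatternLaw.dirac {v}) (PatternLaw.dirac {-v}) (1 / 2) (by norm_num) (by norm_num)
  supported P hP := by
    have h := PatternLaw.support_mix_subset _ _ (1 / 2) (by norm_num) (by norm_num) hP
    rw [PatternLaw.support_dirac, PatternLaw.support_dirac, mem_union, mem_singleton,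
      mem_singleton] at h
    rcases h with rfl | rfl
    · exact isRootedPattern_singleton hv hvR
    · exact isRootedPattern_singleton (by rwa [norm_neg]) (by rwa [norm_neg])
  massTransport g := by
    have hv0 : v ≠ 0 := by
      intro h
      rw [h, norm_zero] at hv
      exact absurd hv (not_le.2 hδ)
    show (PatternLaw.mix (PatternLaw.dirac {v}) (PatternLaw.dirac {-v}) (1 / 2) _ _).expect
        (fun P => ∑ u ∈ lens r R P, g u (ballPattern r P) (ballPattern r (reroot P u))) =
      (PatternLaw.mix (PatternLaw.dirac {v}) (PatternLaw.dirac {-v}) (1 / 2) _ _).expect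
        (fun P => ∑ u ∈ lens r R P, g (-u) (ballPattern r (reroot P u)) (ballPattern r P))
    rw [PatternLaw.expect_mix, PatternLaw.expect_mix, PatternLaw.expect_dirac,
      PatternLaw.expect_dirac, PatternLaw.expect_dirac, PatternLaw.expect_dirac,
      lens_singleton, lens_singleton, norm_neg]
    split_ifs with h
    · rw [sum_singleton, sum_singleton, sum_singleton, sum_singleton,
        reroot_singleton_self hv0, reroot_singleton_self (neg_ne_zero.2 hv0), neg_neg]
      ring
    · simp

end LensConsistentLaw

end Literature.Probability.PointProcesses
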